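import Mathlib.Analysis.SpecialFunctions.Log.Basic
import Summits.CriticalPhenomena.CardyFormulaZ2.Theorems.CardyBoundaryCoulombGasBoundaryDefectGaussianRStubClusterLocalityV2Part5

/-!
# Stub `stub_clusterLocalityV2` of line `rainbow-monomials-in-excursion-kernels` — Part 6:
# the half-box sandwich `G_Q ≤ G_V ≤ G_Q (1 + O(k²/N²))` at a flat boundary stretch
# (crux `BoundaryDefectGaussianR`, stmt-CriticalPhenomena-14132)

Assembly of steps (A) (Part 1), (B) (Part 3) and (C) (Part 5) of the Green-locality half G1 of
`stub_clusterLocalityV2`. Let `x, y` lie on a row, `|x₀ - y₀| ≤ k`, let `Q` be the half-box of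
size `N + k` standing on that row and centred at `x`, and let the finite `V ⊇ Q` miss the row
below `Q` and be flat at scale `8N` around `y` (contain the half-box of size `8N` at `y`, miss
the row below it). Then

* `dirichletGreen_sub_halfBox_le` — TRUNCATION: `0 ≤ G_V(x,y) - G_Q(x,y) ≤ 48/(N(N+k+1))`
  (Green's representation of `G_V(·,y)` on `Q`: the excess is the `H_Q(x,·)`-average over the
  far sides of `∂Q` — harmonic measure `≤ 2/(N+k+1)` by (A) — of `G_V(·,y) ≤ 24/N` there by (B));
* `dirichletGreen_halfBox_lower` — `G_Q(x,y) ≥ c₁/(50k+1)²` for `N ≥ 816k` by (C);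
* `abs_log_dirichletGreen_sub_le` — hence `G_V(x,y) > 0` and
  `|log G_V(x,y) - log G_Q(x,y)| ≤ 48(50k+1)²/(c₁ N (N+k+1))`, a bound depending on `V` only
  through the flat half-box: the source of LOCALITY (Part 7 compares two such `V`, `V'`).

All statements are folklore (Lawler–Limic 2010, §6.2–6.3, §8.1).
-/

noncomputable section

namespace Summit.CriticalPhenomena.CardyFormulaZ2.Cruxes.BoundaryDefectGaussianR.RainbowMonomialsInExcursionKernels

open Finset Literature.Probability.LatticeModels

/-! ### Truncation to the half-box -/

/-- **Truncation error.** With `Q` the half-box of size `N + k` at `x` (`N ≥ 3`, `k ≥ 1`),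
`Q ⊆ V`, the row below `Q` outside `V`, `V` flat at scale `8N` around the row point `y` with
`|x₀ - y₀| ≤ k`: `G_V(x, y) - G_Q(x, y) ≤ 48/(N (N+k+1))`. [folklore] -/
theorem dirichletGreen_sub_halfBox_le {V Q : Finset (Site 2)} {x y : Site 2} {k N : ℕ}
    (hN : 3 ≤ N)
    (hQ : ∀ v : Site 2, v ∈ Q ↔ (x 0 - (N + k : ℕ) ≤ v 0 ∧ v 0 ≤ x 0 + (N + k : ℕ)) ∧
      (x 1 ≤ v 1 ∧ v 1 ≤ x 1 + (N + k : ℕ)))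
    (hQV : Q ⊆ V)
    (hout : ∀ v : Site 2, x 0 - (N + k : ℕ) ≤ v 0 → v 0 ≤ x 0 + (N + k : ℕ) → v 1 = x 1 - 1 →
      v ∉ V)
    (hinY : ∀ v : Site 2, y 0 - 8 * N ≤ v 0 → v 0 ≤ y 0 + 8 * N → y 1 ≤ v 1 →
      v 1 ≤ y 1 + 8 * N → v ∈ V)
    (houtY : ∀ v : Site 2, y 0 - 8 * N ≤ v 0 → v 0 ≤ y 0 + 8 * N → v 1 = y 1 - 1 → v ∉ V)
    (hy1 : y 1 = x 1) (hxy : |x 0 - y 0| ≤ k) :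
    dirichletGreen V x y - dirichletGreen Q x y ≤ 48 / ((N : ℝ) * (((N + k : ℕ) : ℝ) + 1)) := by
  have hd : 0 < 2 := by norm_num
  have hxy' := abs_le.1 hxy
  have hNpos : (0 : ℝ) < N := by exact_mod_cast (show 0 < N by omega)
  have hxQ : x ∈ Q := self_mem_halfRect hQ
  have hyQ : y ∈ Q := by rw [hQ]; push_cast; omega
  -- `F = G_V(·, y)` and its representation on `Q`
  set F : Site 2 → ℝ := fun w => dirichletGreen V w y with hF
  have F_eq : F = dirichletGreen V y := by funext w; exact dirichletGreen_comm V w y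
  have hrep := green_representation hd Q F hxQ
  have hvol : ∑ w ∈ Q, dirichletGreen Q x w * (-latticeLaplacianZd F w) = dirichletGreen Q x y := by
    have : ∀ w ∈ Q, dirichletGreen Q x w * (-latticeLaplacianZd F w) =
        if y = w then dirichletGreen Q x w else 0 := fun w hw => by
      rw [F_eq, neg_latticeLaplacianZd_dirichletGreen hd V y (hQV hw)]
      split_ifs <;> simp
    rw [Finset.sum_congr rfl this, Finset.sum_ite_eq, if_pos hyQ]
  rw [hvol] at hrep
  -- the boundary terms: zero on the bottom row, `≤ 24/N` on the far sides
  have hpt : ∀ z ∈ outerBoundary (zdGraph 2) Q, poissonKernel Q x z * F z ≤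
      24 / N * (if x 1 ≤ z 1 then poissonKernel Q x z else 0) := by
    intro z hz
    have hH := poissonKernel_nonneg hd Q x z
    rcases outerBoundary_halfRect hQ hz with h | h | h
    · rw [if_neg (by omega)]
      have hzV : z ∉ V := hout z h.2.1 h.2.2 h.1
      simp only [hF, dirichletGreen_of_not_mem_left V hzV, mul_zero]
      exact le_rfl
    · rw [if_pos (by omega), mul_comm (24 / (N : ℝ))]
      refine mul_le_mul_of_nonneg_left ?_ hH
      exact dirichletGreen_decay hN hinY houtY (by push_cast at h; omega)
    · rw [if_pos (by omega), mul_comm (24 / (N : ℝ))]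
      refine mul_le_mul_of_nonneg_left ?_ hH
      exact dirichletGreen_decay hN hinY houtY (by push_cast at h; omega)
  have hfar := sum_poissonKernel_far_le hQ
  calc dirichletGreen V x y - dirichletGreen Q x y
      = ∑ z ∈ outerBoundary (zdGraph 2) Q, poissonKernel Q x z * F z := by
        show F x - dirichletGreen Q x y = _
        rw [hrep]; ring
    _ ≤ ∑ z ∈ outerBoundary (zdGraph 2) Q,
        24 / N * (if x 1 ≤ z 1 then poissonKernel Q x z else 0) := Finset.sum_le_sum hpt
    _ = 24 / N * ∑ z ∈ (outerBoundary (zdGraph 2) Q).filter (fun z => x 1 ≤ z 1),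
        poissonKernel Q x z := by rw [← Finset.mul_sum, Finset.sum_filter]
    _ ≤ 24 / N * (2 / (((N + k : ℕ) : ℝ) + 1)) := by gcongr
    _ = 48 / ((N : ℝ) * (((N + k : ℕ) : ℝ) + 1)) := by
        field_simp; ring

/-- **The half-box lower bound**: for the half-box `Q` of size `N + k` at `x` with `N ≥ 816k`,
`k ≥ 1`, and `y` on the row of `x` with `|x₀ - y₀| ≤ k`: `G_Q(x, y) ≥ c₁/(50k+1)²`,
`c₁ = (15/152)(c_*/2)¹⁸` (Part 5, the wide rectangle of step (C) fits in `Q`). [folklore] -/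
theorem dirichletGreen_halfBox_lower {Q : Finset (Site 2)} {x y : Site 2} {k N : ℕ} (hk : 1 ≤ k)
    (hN : 816 * k ≤ N)
    (hQ : ∀ v : Site 2, v ∈ Q ↔ (x 0 - (N + k : ℕ) ≤ v 0 ∧ v 0 ≤ x 0 + (N + k : ℕ)) ∧
      (x 1 ≤ v 1 ∧ v 1 ≤ x 1 + (N + k : ℕ)))
    (hy1 : y 1 = x 1) (hxy : |x 0 - y 0| ≤ k) :
    15 / 152 * (maneuverConst / 2) ^ 18 / (50 * (k : ℝ) + 1) ^ 2 ≤ dirichletGreen Q x y :=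
  dirichletGreen_row_lower_of_subset hk (fun v h1 h2 h3 h4 => by rw [hQ]; push_cast; omega)
    hy1 hxy

/-- `|log G - log g| ≤ E/g` when `0 < g ≤ G ≤ g + E` (`log t ≤ t - 1`). [folklore] -/
theorem abs_log_sub_log_le {g G E : ℝ} (hg : 0 < g) (hgG : g ≤ G) (hGE : G - g ≤ E) :
    |Real.log G - Real.log g| ≤ E / g := by
  have hG : 0 < G := lt_of_lt_of_le hg hgG
  rw [abs_of_nonneg (by linarith [Real.log_le_log hg hgG]), ← Real.log_div hG.ne' hg.ne']
  have h1 := Real.log_le_sub_one_of_pos (div_pos hG hg)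
  have h2 : G / g - 1 = (G - g) / g := by field_simp
  rw [h2] at h1
  exact h1.trans (div_le_div_of_nonneg_right hGE hg.le)

/-- **The sandwich, logarithmic form.** Under the hypotheses of `dirichletGreen_sub_halfBox_le`
and `N ≥ 816k`: `G_V(x, y) > 0`, `G_Q(x,y) > 0` and
`|log G_V(x,y) - log G_Q(x,y)| ≤ 48 (50k+1)² / (c₁ N (N+k+1))`. [folklore] -/
theorem abs_log_dirichletGreen_sub_le {V Q : Finset (Site 2)} {x y : Site 2} {k N : ℕ}
    (hk : 1 ≤ k) (hN : 816 * k ≤ N)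
    (hQ : ∀ v : Site 2, v ∈ Q ↔ (x 0 - (N + k : ℕ) ≤ v 0 ∧ v 0 ≤ x 0 + (N + k : ℕ)) ∧
      (x 1 ≤ v 1 ∧ v 1 ≤ x 1 + (N + k : ℕ)))
    (hQV : Q ⊆ V)
    (hout : ∀ v : Site 2, x 0 - (N + k : ℕ) ≤ v 0 → v 0 ≤ x 0 + (N + k : ℕ) → v 1 = x 1 - 1 →
      v ∉ V)
    (hinY : ∀ v : Site 2, y 0 - 8 * N ≤ v 0 → v 0 ≤ y 0 + 8 * N → y 1 ≤ v 1 →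
      v 1 ≤ y 1 + 8 * N → v ∈ V)
    (houtY : ∀ v : Site 2, y 0 - 8 * N ≤ v 0 → v 0 ≤ y 0 + 8 * N → v 1 = y 1 - 1 → v ∉ V)
    (hy1 : y 1 = x 1) (hxy : |x 0 - y 0| ≤ k) :
    0 < dirichletGreen Q x y ∧ 0 < dirichletGreen V x y ∧
      |Real.log (dirichletGreen V x y) - Real.log (dirichletGreen Q x y)| ≤
        48 * (50 * (k : ℝ) + 1) ^ 2 / (15 / 152 * (maneuverConst / 2) ^ 18 *
          ((N : ℝ) * (((N + k : ℕ) : ℝ) + 1))) := by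
  have hd : 0 < 2 := by norm_num
  have hN3 : 3 ≤ N := by omega
  have hc₁ : 0 < 15 / 152 * (maneuverConst / 2) ^ 18 := by
    have := maneuverConst_pos; positivity
  have hNpos : (0 : ℝ) < N := by exact_mod_cast (show 0 < N by omega)
  have hlow := dirichletGreen_halfBox_lower hk hN hQ hy1 hxy
  have hg : 0 < dirichletGreen Q x y := lt_of_lt_of_le (by positivity) hlow
  have hgG : dirichletGreen Q x y ≤ dirichletGreen V x y := dirichletGreen_mono hd hQV x y
  have hE := dirichletGreen_sub_halfBox_le hN3 hQ hQV hout hinY houtY hy1 hxy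
  refine ⟨hg, lt_of_lt_of_le hg hgG, (abs_log_sub_log_le hg hgG hE).trans ?_⟩
  -- `E / G_Q ≤ E / (c₁/(50k+1)²)`
  calc 48 / ((N : ℝ) * (((N + k : ℕ) : ℝ) + 1)) / dirichletGreen Q x y
      ≤ 48 / ((N : ℝ) * (((N + k : ℕ) : ℝ) + 1)) /
          (15 / 152 * (maneuverConst / 2) ^ 18 / (50 * (k : ℝ) + 1) ^ 2) :=
        div_le_div_of_nonneg_left (by positivity) (by positivity) hlow
    _ = 48 * (50 * (k : ℝ) + 1) ^ 2 / (15 / 152 * (maneuverConst / 2) ^ 18 *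
          ((N : ℝ) * (((N + k : ℕ) : ℝ) + 1))) := by
        field_simp

/-! ### Registered sub-goal of the stub carried by this file -/

/-- **Sub-goal `s10_greenTruncation`** (registered on stmt-CriticalPhenomena-14132; assembly
step of the Green-locality half G1 of `stub_clusterLocalityV2`): the truncation error
`G_V(x,y) - G_Q(x,y) ≤ 48/(N(N+k+1))` of the Green function at two flat boundary-row points
to the half-box `Q` of size `N + k`, for every finite `V ⊇ Q` missing the row below `Q` and flat
at scale `8N` around `y` (`dirichletGreen_sub_halfBox_le`). [folklore] -/
theorem s10_greenTruncation : ∀ (V Q : Finset (Literature.Probability.LatticeModels.Site 2)) (x y : Literature.Probability.LatticeModels.Site 2) (k N : ℕ), 3 ≤ N → (∀ v : Literature.Probability.LatticeModels.Site 2, v ∈ Q ↔ (x 0 - (N + k : ℕ) ≤ v 0 ∧ v 0 ≤ x 0 + (N + k : ℕ)) ∧ (x 1 ≤ v 1 ∧ v 1 ≤ x 1 + (N + k : ℕ))) → Q ⊆ V → (∀ v : Literature.Probability.LatticeModels.Site 2, x 0 - (N + k : ℕ) ≤ v 0 → v 0 ≤ x 0 + (N + k : ℕ) → v 1 = x 1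 - 1 → v ∉ V) → (∀ v : Literature.Probability.LatticeModels.Site 2, y 0 - 8 * N ≤ v 0 → v 0 ≤ y 0 + 8 * N → y 1 ≤ v 1 → v 1 ≤ y 1 + 8 * N → v ∈ V) → (∀ v : Literature.Probability.LatticeModels.Site 2, y 0 - 8 * N ≤ v 0 → v 0 ≤ y 0 + 8 * N → v 1 = y 1 - 1 → v ∉ V) → y 1 = x 1 → |x 0 - y 0| ≤ k → Literature.Probability.LatticeModels.dirichletGreen V x y - Literature.Probability.LatticeModels.dirichletGreen Q x y ≤ 48 / ((N : ℝ) * (((N + k : ℕ) : ℝ) + 1)) :=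
  fun _ _ _ _ _ _ hN hQ hQV hout hinY houtY hy1 hxy =>
    dirichletGreen_sub_halfBox_le hN hQ hQV hout hinY houtY hy1 hxy

end Summit.CriticalPhenomena.CardyFormulaZ2.Cruxes.BoundaryDefectGaussianR.RainbowMonomialsInExcursionKernels

end
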